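import Mathlib
import Literature.NumberTheory.LFunctions.Zhang2022.TypedSection18
import Literature.NumberTheory.LFunctions.Zhang2022.TypedSection10C
import Literature.NumberTheory.LFunctions.Zhang2022.Section10CRanges1422
import HarnessLib

/-!
# Zhang (2022) §18 p. 100: the window main terms `main18u010` / `main18u011(b)` as `lamAvg` sums

Topic `Literature/NumberTheory/LFunctions/Zhang2022` (Landau–Siegel audit tree; verdict-neutral).
Y. Zhang, *Discrete mean estimates and the Landau–Siegel zero*, arXiv:2211.02515v1 (2022)
[Zhang2022LandauSiegel], §18 p. 100 (tex L4934–L4941): the printed main terms of the second and third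
`dr`-ranges of `S_j(𝐚₂₃,𝐚₂₃)`,
`(500L′(1,χ)/log P)² Σ_{P^{0.5} ≤ n < P^{0.502}} |χ(n)|λ₀ⱼ(n)φ(n)⁻¹(−1 − β_j log(n/P^{0.5}))(−1 + 𝒴₁ⱼ(n))`
and its twin on `[P^{0.502}, P^{0.504})` — **an unrefereed manuscript under adjudication; this file
proves bookkeeping identities only and asserts nothing about its Theorems 1–2 or about Landau–Siegel
zeros.** ZHANG-L discharge lane, theorem-only TOOL file (zl-w10-p1 as helper of zl-closer-2 on the
RT-08 edge `… → Skeleton.Ineq233With c′ C233`; consumer: the §10-type "second line"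
`Typed.Sec10C.lamAvg_second_line` applied to these two windows). 0 definitions.

* `win1Set_eq`, `win2Set_eq` — the filtered index sets `{1 ≤ n < ⌈PT⁻²⌉ : P^{0.5} ≤ n < P^{0.502}}`
  and `{… : P^{0.502} ≤ n < P^{0.504}}` are the intervals `[⌈P^{0.5}⌉, ⌈P^{0.502}⌉)`,
  `[⌈P^{0.502}⌉, ⌈P^{0.504}⌉)` (`P^{0.504} ≤ PT⁻²` for `𝓛 ≥ 3`, `Sec10B.rpow504_le_nsuppBound`);
* `main18u010_eq_lamAvg` — `main18u010 = 250000·L′(1,χ)²/(log P)² · lamAvg j P^{0.5} P^{0.502} F₁`,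
  `F₁(t) = (−1 − β_j log(t/P^{0.5}))(−1 + 𝒴₁ⱼ(t))`, literally the left side of
  `Typed.Sec10C.lamAvg_second_line` with `κ = 250000`, `a = 0.5`, `b = 0.502`;
* `main18u011b_eq_lamAvg` (`F₂(t) = (1 − β_j log(P^{0.504}/t))(1 + 𝒴₂ⱼ(t))`, `a = 0.502`, `b = 0.504`)
  and `main18u011_eq_lamAvg` (the printed `𝒴₁ⱼ` variant).

## References

* Y. Zhang, arXiv:2211.02515v1 (2022), §18 p. 100; §10 pp. 57–61. [cite: Zhang2022LandauSiegel, §18 p.100]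
-/

noncomputable section

open Complex Real ComplexConjugate
open Literature.NumberTheory.LFunctions.Zhang2022.Skeleton

namespace Literature.NumberTheory.LFunctions.Zhang2022.Typed.Section18

variable (c' : ℝ) {D : ℕ} (χ : DirichletCharacter ℂ D)

section MainSumsLamAvg

/-! ## The two window index sets -/

omit χ in
/-- The filtered index set of the second `dr`-range of `S_j(𝐚₂₃,𝐚₂₃)` is `[⌈P^{0.5}⌉, ⌈P^{0.502}⌉)`
(`𝓛 ≥ 3`). [cite: Zhang2022LandauSiegel, §18 p.100] -/
theorem win1Set_eq (hℓ : 3 ≤ ell D) :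
    (Finset.Ico 1 (Nsupp D)).filter
        (fun n : ℕ => bigP D ^ (0.5 : ℝ) ≤ (n : ℝ) ∧ (n : ℝ) < bigP D ^ (0.502 : ℝ)) =
      Finset.Ico ⌈bigP D ^ (0.5 : ℝ)⌉₊ ⌈bigP D ^ (0.502 : ℝ)⌉₊ := by
  obtain ⟨h2, h68, h85, h54, -, -, hN⟩ := Sec10C.Ranges1422.range_facts (D := D) hℓ
  have hP1 : 1 ≤ bigP D := by
    have := Real.one_le_exp (show (0 : ℝ) ≤ ell D ^ 9 by positivity); rwa [bigP]
  have h24 : bigP D ^ (0.502 : ℝ) ≤ bigP D ^ (0.504 : ℝ) :=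
    Real.rpow_le_rpow_of_exponent_le hP1 (by norm_num)
  ext n
  simp only [Finset.mem_filter, Finset.mem_Ico]
  constructor
  · rintro ⟨⟨-, -⟩, ha, hb⟩
    exact ⟨Nat.ceil_le.mpr ha, Nat.lt_ceil.mpr hb⟩
  · rintro ⟨ha, hb⟩
    have ha' : bigP D ^ (0.5 : ℝ) ≤ n := Nat.ceil_le.mp ha
    have hb' : (n : ℝ) < bigP D ^ (0.502 : ℝ) := Nat.lt_ceil.mp hb
    refine ⟨⟨?_, hN n (hb'.trans_le h24)⟩, ha', hb'⟩
    have : (1 : ℝ) ≤ n := by linarith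
    exact_mod_cast this

omit χ in
/-- The filtered index set of the third `dr`-range of `S_j(𝐚₂₃,𝐚₂₃)` is `[⌈P^{0.502}⌉, ⌈P^{0.504}⌉)`
(`𝓛 ≥ 3`; `P^{0.504} ≤ PT⁻²`). [cite: Zhang2022LandauSiegel, §18 p.100] -/
theorem win2Set_eq (hℓ : 3 ≤ ell D) :
    (Finset.Ico 1 (Nsupp D)).filter
        (fun n : ℕ => bigP D ^ (0.502 : ℝ) ≤ (n : ℝ) ∧ (n : ℝ) < bigP D ^ (0.504 : ℝ)) =
      Finset.Ico ⌈bigP D ^ (0.502 : ℝ)⌉₊ ⌈bigP D ^ (0.504 : ℝ)⌉₊ := by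
  obtain ⟨h2, h68, h85, h54, -, -, hN⟩ := Sec10C.Ranges1422.range_facts (D := D) hℓ
  have hP1 : 1 ≤ bigP D := by
    have := Real.one_le_exp (show (0 : ℝ) ≤ ell D ^ 9 by positivity); rwa [bigP]
  have h52 : bigP D ^ (0.5 : ℝ) ≤ bigP D ^ (0.502 : ℝ) :=
    Real.rpow_le_rpow_of_exponent_le hP1 (by norm_num)
  ext n
  simp only [Finset.mem_filter, Finset.mem_Ico]
  constructor
  · rintro ⟨⟨-, -⟩, ha, hb⟩
    exact ⟨Nat.ceil_le.mpr ha, Nat.lt_ceil.mpr hb⟩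
  · rintro ⟨ha, hb⟩
    have ha' : bigP D ^ (0.502 : ℝ) ≤ n := Nat.ceil_le.mp ha
    have hb' : (n : ℝ) < bigP D ^ (0.504 : ℝ) := Nat.lt_ceil.mp hb
    refine ⟨⟨?_, hN n hb'⟩, ha', hb'⟩
    have : (1 : ℝ) ≤ n := by linarith
    exact_mod_cast this

/-! ## The window main terms as `lamAvg` sums -/

variable [NeZero D]

/-- **`main18u010` in `lamAvg` form** (`𝓛 ≥ 3`):
`main18u010 = 250000·L′(1,χ)²/(log P)²·Σ_{⌈P^{0.5}⌉ ≤ n < ⌈P^{0.502}⌉}|χ(n)|λ₀ⱼ(n)φ(n)⁻¹F₁(n)`,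
`F₁(t) = (−1 − β_j log(t/P^{0.5}))(−1 + 𝒴₁ⱼ(t))` — the left side of `Typed.Sec10C.lamAvg_second_line`
with `κ = 250000`, `a = 0.5`, `b = 0.502`. [cite: Zhang2022LandauSiegel, §18 p.100, tex L4934] -/
theorem main18u010_eq_lamAvg (hℓ : 3 ≤ ell D) (j : ℕ) :
    main18u010 c' χ j =
      250000 * deriv χ.LFunction 1 ^ 2 / (Real.log (bigP D) : ℂ) ^ 2 *
        Sec10C.lamAvg c' χ j (bigP D ^ (0.5 : ℝ)) (bigP D ^ (0.502 : ℝ)) (fun n =>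
          (fun t : ℝ => (-1 - betaJ c' D j * (Real.log (t / bigP D ^ (0.5 : ℝ)) : ℂ)) *
            (-1 + fraky1 c' D j t)) n) := by
  unfold main18u010 Sec10C.lamAvg
  rw [win1Set_eq hℓ, Finset.mul_sum, Finset.mul_sum]
  refine Finset.sum_congr rfl fun n _ => ?_
  ring

/-- **`main18u011b` in `lamAvg` form** (`𝓛 ≥ 3`; the `𝒴₂ⱼ` reading of the third range):
`main18u011b = 250000·L′(1,χ)²/(log P)²·Σ_{⌈P^{0.502}⌉ ≤ n < ⌈P^{0.504}⌉}|χ(n)|λ₀ⱼ(n)φ(n)⁻¹F₂(n)`,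
`F₂(t) = (1 − β_j log(P^{0.504}/t))(1 + 𝒴₂ⱼ(t))` — the left side of `Typed.Sec10C.lamAvg_second_line`
with `κ = 250000`, `a = 0.502`, `b = 0.504`. [cite: Zhang2022LandauSiegel, §18 p.100, tex L4939; §10 (10.10)] -/
theorem main18u011b_eq_lamAvg (hℓ : 3 ≤ ell D) (j : ℕ) :
    main18u011b c' χ j =
      250000 * deriv χ.LFunction 1 ^ 2 / (Real.log (bigP D) : ℂ) ^ 2 *
        Sec10C.lamAvg c' χ j (bigP D ^ (0.502 : ℝ)) (bigP D ^ (0.504 : ℝ)) (fun n =>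
          (fun t : ℝ => (1 - betaJ c' D j * (Real.log (bigP D ^ (0.504 : ℝ) / t) : ℂ)) *
            (1 + fraky2 c' D j t)) n) := by
  unfold main18u011b Sec10C.lamAvg
  rw [win2Set_eq hℓ, Finset.mul_sum, Finset.mul_sum]
  refine Finset.sum_congr rfl fun n _ => ?_
  ring

/-- **`main18u011` (as printed, with `𝒴₁ⱼ`) in `lamAvg` form** (`𝓛 ≥ 3`).
[cite: Zhang2022LandauSiegel, §18 p.100, tex L4939] -/
theorem main18u011_eq_lamAvg (hℓ : 3 ≤ ell D) (j : ℕ) :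
    main18u011 c' χ j =
      250000 * deriv χ.LFunction 1 ^ 2 / (Real.log (bigP D) : ℂ) ^ 2 *
        Sec10C.lamAvg c' χ j (bigP D ^ (0.502 : ℝ)) (bigP D ^ (0.504 : ℝ)) (fun n =>
          (fun t : ℝ => (1 - betaJ c' D j * (Real.log (bigP D ^ (0.504 : ℝ) / t) : ℂ)) *
            (1 + fraky1 c' D j t)) n) := by
  unfold main18u011 Sec10C.lamAvg
  rw [win2Set_eq hℓ, Finset.mul_sum, Finset.mul_sum]
  refine Finset.sum_congr rfl fun n _ => ?_
  ring

end MainSumsLamAvg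

end Literature.NumberTheory.LFunctions.Zhang2022.Typed.Section18
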